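import Summits.AtomisticToContinuum.Crystallization.Theorems.ChargedEnergyGapFeetLawA
import HarnessLib

/-!

K-FORM (decomp-a2c hand-2 g42, critic row 1590 route (R-i′)): every cap-dependent reference in the CODE of this file reads the κ-WINDOW-LETTER twins of
`…ChargedEnergyGapDominoLedgerK` (`domCapK`, `DominoLawQ'K`, `IsDominantK`, `domLoadK`/`domMomentK`, `ballMatchingSingleQ'_designate_of_dominoLedgerK`,
`thawSplit_leaves_of_dominoLedger_leavesK`, `chargedEnergyGap_of_dominoLedger_numericsK`, …); this file's OWN declaration names are lens-3's (first landing).  The prose below is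
lens-3's r1586 (BYTES-90) text verbatim: where it says `domCap` / `DominoLawQ'` / «the tree's cap» it discusses the g88 cap and its κ repair, which the code now reads as `domCapK`.
# ChargedEnergyGap · NODE 90 «FeetLaw» — main (§90.4 Glue: (D¹) ∧ (D²) ⟹ (DL); §90.5 designate + cone)

Mechanical cut of the lens-3 g89 node file `ChargedEnergyGapFeetLaw.lean` (monolith, 667 lines) at its section boundaries for the 400-line
statement-form cap: part A = §90.1–§90.3 (the feet calculus and the two pieces (D¹) `SoloFeetLawQ` / (D²) `PairFeetLawQ`, the anchored frames,
the stencil dictionary), main = §90.4–§90.5 (this file: the octahedron / feet-set / single-crossing lemmas, the glue `dominoLawQ'_of_feetLaws`,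
the designate, the by-name record and the cone `chargedEnergyGap_of_feetLaw_numerics`).  Same namespace, proof bodies verbatim, all FQNs
unchanged; the thesis, tags and numbers are in the module docstring of part A. -/

noncomputable section
open scoped Classical
open Literature.MathematicalPhysics.StatisticalMechanics Literature.Geometry.DiscreteGeometry
open Summit.AtomisticToContinuum.Crystallization.Theses.PricedLinkCensus
open Summit.AtomisticToContinuum.Crystallization.Theorems.ChargedEnergyGapNegative

namespace Summit.AtomisticToContinuum.Crystallization.Theorems.ChargedEnergyGapChartDial

/-! ## §90.4 The glue: (D¹) ∧ (D²) ⟹ (DL), for any class and constants (`0 < s`, `0 < ϱ`, `0 < ϱχ`, `0 ≤ r₁`, `2(r₁ + r₂) < ϱχ/2`, `0 < ρlo`) -/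
section Glue90

variable {ϱχ : ℝ} {m : ℕ} {D : Fin m → Set E3} {σ : Fin m → Bool}

/-- Small `Fin 3` facts. [formal bookkeeping] -/
private theorem fin3_succ_ne (a : Fin 3) : a + 1 ≠ a := by revert a; decide

/-- [formal bookkeeping] -/
theorem fin3_succ_succ_ne (a : Fin 3) : a + 2 ≠ a ∧ a + 2 ≠ a + 1 := by revert a; decide

/-- [formal bookkeeping] -/
theorem fin3_ne_cases (a i : Fin 3) (h : i ≠ a) : i = a + 1 ∨ i = a + 2 := by revert a i; decide

/-- The `(a+1)`-coordinates of two holes with the same domino key round down to the same even integer, and their `(a+2)`-coordinates agree.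
[formal bookkeeping] -/
theorem domKey_coords {a : Fin 3} {w w₁ : Fin 3 → ℤ} (h : domKey a w₁ = domKey a w) :
    w₁ (a + 1) - w₁ (a + 1) % 2 = w (a + 1) - w (a + 1) % 2 ∧ w₁ (a + 2) = w (a + 2) := by
  have h1 := congr_fun h (a + 1)
  have h2 := congr_fun h (a + 2)
  unfold domKey at h1 h2
  rw [if_neg (fin3_succ_ne a), if_neg (fin3_succ_ne a), if_pos rfl, if_pos rfl] at h1
  rw [if_neg (fin3_succ_succ_ne a).1, if_neg (fin3_succ_succ_ne a).1, if_neg (fin3_succ_succ_ne a).2, if_neg (fin3_succ_succ_ne a).2] at h2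
  exact ⟨h1, h2⟩

/-- ★ **THE MARKED OCTAHEDRON (PROVED)**: a hole `w` marked at `x` (by a heavy active line pair) in a cubic frame of a framed reference has:
`C ≠ ∅`; ALL SIX ordered pole pairs spanning the lattice octahedron (`InOct` = the six frame vertices: (LS) applied to each pole pair, which is a
mid pair of the reference); vertex weights `siteW = φ_ϱ ∘ (lattice depth of C)` (clean, χ-free, non-plateau: `crease_frame`); and a vertex of depth
`< dK` (active ⇒ not deep). -/
theorem marked_octahedron {R_N r_f dK dstar κ c_T cχ τ ϱ r₁ r₂ ρlo ρhi : ℝ} {P : PeriodicConfiguration 3} {C X : Set E3} {c₀ : E3}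
    {f : Fin 3 → E3} {ρ : ℝ} (hϱ : 0 < ϱ) (hϱχ : 0 < ϱχ) (hr₁ : 0 ≤ r₁) (hsmall : 2 * (r₁ + r₂) < ϱχ / 2) (hlo : 0 < ρlo)
    (hFr : IsFramedOct P r₁ r₂ ρlo ρhi) (hf : Orthonormal ℝ f) (hρ : 0 < ρ) (hCF : IsCubicFrameOf P r₁ r₂ c₀ f ρ) {x : E3} {w : Fin 3 → ℤ}
    (hw : IsMarked ϱχ D σ R_N r_f dK dstar κ c_T cχ P C X τ ϱ r₁ r₂ c₀ f ρ x w) :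
    C.Nonempty ∧
      (∀ (a : Fin 3) (b : Bool) (x' : E3), InOct P r₁ (octVertex (cubicPt c₀ f ρ w) f ρ a (!b)) (octVertex (cubicPt c₀ f ρ w) f ρ a b) x' ↔
        ∃ (i : Fin 3) (b' : Bool), x' = octVertex (cubicPt c₀ f ρ w) f ρ i b') ∧
      (∀ u : Fin 3 × Bool, siteW ϱχ D σ X ϱ C (cubicPt c₀ f ρ (holeVertex w u)) = depthProfile ϱ (latDepth C c₀ f ρ (holeVertex w u))) ∧
      hDepthMin (latDepth C c₀ f ρ) w < dK := by
  obtain ⟨-, y', z', hH, hLp, -, hcen⟩ := hw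
  obtain ⟨⟨hy0, hz0, hd1, hd2⟩, hclean, hplat, hncf, -⟩ := hH.1
  obtain ⟨w0, a, b, -, hy, hz, hO⟩ := hCF.2 y' z' hy0 hz0 hd1 hd2
  have hc : cubicPt c₀ f ρ w0 = cubicPt c₀ f ρ w := by rw [← hcen, hy, hz, lm_octCentre_poles]
  have hww : w0 = w := lm_cubicPt_injective hf hρ.ne' hc
  subst hww
  have hcf : OctChiFree ϱχ D P r₁ y' z' := hLp.1
  obtain ⟨c', f', ρ', q, -, -, -, -, -, -, -, hq, -, -, -, hWx, -⟩ :=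
    crease_frame (σ := σ) hϱ hϱχ hr₁ hsmall hlo hFr hy0 hz0 hd1 hd2 hclean hplat hcf
  have hne : C.Nonempty := closure_nonempty_iff.1 ⟨q (0, false), (hq (0, false)).1⟩
  have hvert : ∀ u : Fin 3 × Bool, InOct P r₁ y' z' (cubicPt c₀ f ρ (holeVertex w0 u)) := fun u =>
    (hO _).2 ⟨u.1, u.2, lm_cubicPt_holeVertex c₀ f ρ w0 u⟩
  have hdist : dist y' z' = 2 * ρ := by rw [hy, hz, lm_dist_poles hf hρ]
  refine ⟨hne, fun a' b'' => ?_, fun u => ?_, ?_⟩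
  · -- the pole pair `(a', b'')` is a mid pair of the reference with the same centre
    set y'' := octVertex (cubicPt c₀ f ρ w0) f ρ a' (!b'') with hy''
    set z'' := octVertex (cubicPt c₀ f ρ w0) f ρ a' b'' with hz''
    have hy1 : y'' ∈ P.points := ((hO y'').2 ⟨a', !b'', rfl⟩).1
    have hz1 : z'' ∈ P.points := ((hO z'').2 ⟨a', b'', rfl⟩).1
    have hd'' : dist y'' z'' = 2 * ρ := lm_dist_poles hf hρ _ a' b''
    have hd1' : r₁ < dist y'' z'' := by rw [hd'']; exact hdist ▸ hd1
    have hd2' : dist y'' z'' ≤ r₂ := by rw [hd'']; exact hdist ▸ hd2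
    obtain ⟨w₂, a₂, b₂, -, hy₂, hz₂, hO₂⟩ := hCF.2 y'' z'' hy1 hz1 hd1' hd2'
    have hc₂ : cubicPt c₀ f ρ w₂ = cubicPt c₀ f ρ w0 := by
      rw [← lm_octCentre_poles (cubicPt c₀ f ρ w₂) f ρ a₂ b₂, ← hy₂, ← hz₂, hy'', hz'', lm_octCentre_poles]
    have hw₂ : w₂ = w0 := lm_cubicPt_injective hf hρ.ne' hc₂
    rw [hw₂] at hO₂
    exact hO₂
  · rw [hWx _ (hvert u), profileWeight_eq_depthProfile]
    rfl
  · -- active and χ-free ⇒ not deep: a vertex of depth `< dK`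
    have hndeep : ¬OctDeep dK C P r₁ y' z' := fun hdp => hncf ⟨hcf, Or.inr hdp⟩
    unfold OctDeep at hndeep
    push Not at hndeep
    obtain ⟨x', hx', hlt⟩ := hndeep
    obtain ⟨i, b', rfl⟩ := (hO x').1 hx'
    rw [← lm_cubicPt_holeVertex c₀ f ρ w0 (i, b')] at hlt
    exact lt_of_le_of_lt (Finset.inf'_le _ (Finset.mem_univ (i, b'))) hlt

/-- ★ **THE HOLE COST THROUGH THE DICTIONARY (PROVED)**: for a marked hole, `holeCost ≤ feetHoleCost ∘ (lattice depth field of C)`. -/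
theorem holeCost_le_feetHoleCost {R_N r_f dK dstar κ c_T cχ τ ϱ r₁ r₂ ρlo ρhi : ℝ} {P : PeriodicConfiguration 3} {C X : Set E3} {c₀ : E3}
    {f : Fin 3 → E3} {ρ : ℝ} (hϱ : 0 < ϱ) (hϱχ : 0 < ϱχ) (hr₁ : 0 ≤ r₁) (hsmall : 2 * (r₁ + r₂) < ϱχ / 2) (hlo : 0 < ρlo)
    (hFr : IsFramedOct P r₁ r₂ ρlo ρhi) (hf : Orthonormal ℝ f) (hρ : 0 < ρ) (hCF : IsCubicFrameOf P r₁ r₂ c₀ f ρ) {x : E3} {w : Fin 3 → ℤ}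
    (hw : IsMarked ϱχ D σ R_N r_f dK dstar κ c_T cχ P C X τ ϱ r₁ r₂ c₀ f ρ x w) :
    holeCost τ (siteW ϱχ D σ X ϱ C) P r₁ c₀ f ρ w ≤ feetHoleCost ϱ τ ρ (latDepth C c₀ f ρ) w := by
  obtain ⟨-, hO, hW, -⟩ := marked_octahedron hϱ hϱχ hr₁ hsmall hlo hFr hf hρ hCF hw
  refine (holeCost_le_anchored hf hρ hO).trans (le_of_eq ?_)
  unfold feetHoleCost
  refine Finset.sum_congr rfl fun u _ => ?_
  have h : (fun p => siteW ϱχ D σ X ϱ C (cubicPt c₀ f ρ (holeVertex w (anchorLab u p)))) =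
      fun p => depthProfile ϱ (latDepth C c₀ f ρ (holeVertex w (anchorLab u p))) := by
    funext p
    exact hW _
  rw [h]

/-- ★ **THE MARKED HOLE IS FEET-ADMISSIBLE (PROVED)**: `lm_marked_admissible` + not deep. -/
theorem isFeetHole_of_marked {R_N r_f dK dstar κ c_T cχ τ ϱ r₁ r₂ ρlo ρhi : ℝ} {P : PeriodicConfiguration 3} {C X : Set E3} {c₀ : E3}
    {f : Fin 3 → E3} {ρ : ℝ} (hϱ : 0 < ϱ) (hϱχ : 0 < ϱχ) (hr₁ : 0 ≤ r₁) (hsmall : 2 * (r₁ + r₂) < ϱχ / 2) (hlo : 0 < ρlo)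
    (hFr : IsFramedOct P r₁ r₂ ρlo ρhi) (hf : Orthonormal ℝ f) (hρ : 0 < ρ) (hCF : IsCubicFrameOf P r₁ r₂ c₀ f ρ) {x : E3} {w : Fin 3 → ℤ}
    (hw : IsMarked ϱχ D σ R_N r_f dK dstar κ c_T cχ P C X τ ϱ r₁ r₂ c₀ f ρ x w) : IsFeetHole dK ρ (latDepth C c₀ f ρ) w := by
  obtain ⟨hodd, -, hrow, hcol, h140⟩ := lm_marked_admissible hf hρ hCF x w hw
  exact ⟨hodd, hrow, hcol, h140, (marked_octahedron hϱ hϱχ hr₁ hsmall hlo hFr hf hρ hCF hw).2.2.2⟩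

/-- ★★ **SINGLE CROSSING ON A DOMINO (PROVED)**: in a single-crossing ball, two holes marked at a site `x` of the ball, both on the domino of `w`,
with the same `(a+1)`-coordinate (`a` the attributed axis of `w`) COINCIDE — they lie on one `a`-line with the same attributed axis. -/
theorem marked_domino_line {R_N r_f dK dstar κ c_T cχ τ ϱ r₁ r₂ : ℝ} {P : PeriodicConfiguration 3} {C X : Set E3} {c₀ : E3}
    {f : Fin 3 → E3} {ρ : ℝ} {y x : E3} (hSC : IsSingleCrossingBall ϱχ D σ R_N r_f dK dstar κ c_T cχ P C X τ ϱ r₁ r₂ c₀ f ρ y)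
    (hx : x ∈ P.points) (hxy : dist x y ≤ R_N) {w w₁ w₂ : Fin 3 → ℤ}
    (hm₁ : IsMarked ϱχ D σ R_N r_f dK dstar κ c_T cχ P C X τ ϱ r₁ r₂ c₀ f ρ x w₁)
    (hm₂ : IsMarked ϱχ D σ R_N r_f dK dstar κ c_T cχ P C X τ ϱ r₁ r₂ c₀ f ρ x w₂)
    (hs₁ : SameDomino ρ (latDepth C c₀ f ρ) w w₁) (hs₂ : SameDomino ρ (latDepth C c₀ f ρ) w w₂)
    (h : w₁ (hAxis ρ (latDepth C c₀ f ρ) w + 1) = w₂ (hAxis ρ (latDepth C c₀ f ρ) w + 1)) : w₁ = w₂ := by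
  set a := hAxis ρ (latDepth C c₀ f ρ) w with ha
  have h2 : w₁ (a + 2) = w₂ (a + 2) := (domKey_coords hs₁.2).2.trans (domKey_coords hs₂.2).2.symm
  have hline : SameLine a w₁ w₂ := by
    intro i hi
    rcases fin3_ne_cases a i hi with rfl | rfl
    · exact h
    · exact h2
  have hmem : w₂ ∈ lineFiber ρ (latDepth C c₀ f ρ) (IsMarked ϱχ D σ R_N r_f dK dstar κ c_T cχ P C X τ ϱ r₁ r₂ c₀ f ρ x) w₁ := by
    refine ⟨hm₂, hs₂.1.trans hs₁.1.symm, ?_⟩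
    rw [hs₁.1]
    exact hline
  exact (hSC x hx hxy w₁ w₂ hm₁ hmem).symm

/-- ★★★ **GLUE OF NODE 90 (PROVED)**: (D¹) ∧ (D²) ⟹ (DL) `DominoLawQ'`, for ANY class and constants with `0 < s`, `0 < ϱ`, `0 < ϱχ`, `0 ≤ r₁`,
`2(r₁ + r₂) < ϱχ/2`, `0 < ρlo`.  The marked holes on the domino of the dominant hole `w` are `w` alone or `w` and ONE partner `w'` on the other line
(single crossing); their thawed hole costs are at most their feet hole costs for the depth field of `C` (explicit anchored frames, clean χ-free
non-plateau octahedra: `W = φ ∘ depth`), which equal the feet hole costs for the NEAREST-POINT OBSTACLE `S` (≤ 7 / ≤ 14 points) together with every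
descriptor (min-depth, kinks, axis, domino key, sheet depth, cap); the solo / pair law bounds them by `Ĉ(sheet depth of w)`. -/
theorem dominoLawQ'_of_feetLaws {cls : Set E3 → Prop} {R_N r_f dK dstar κ c_T cχ unit s lam ℓ τ ϱ ϱχ r₁ r₂ ρlo ρhi : ℝ}
    (hs : 0 < s) (hϱ : 0 < ϱ) (hϱχ : 0 < ϱχ) (hr₁ : 0 ≤ r₁) (hsmall : 2 * (r₁ + r₂) < ϱχ / 2) (hlo : 0 < ρlo)
    (hD1 : SoloFeetLawQ dK unit ϱ τ ρlo ρhi) (hD2 : PairFeetLawQ dK unit ϱ τ ρlo ρhi) :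
    DominoLawQ'K cls R_N r_f dK dstar κ c_T cχ unit s lam ℓ τ ϱ ϱχ r₁ r₂ ρlo ρhi := by
  intro P C X m D σ h1 _ _ _ _ _ _ _ _ hFr c₀ f ρ hf hρ1 hρ2 hCF y z _ _ hSC x hx hxy w hdom
  have hρ : 0 < ρ := hlo.trans_le hρ1
  set d := latDepth C c₀ f ρ with hd
  set mk := IsMarked ϱχ D σ R_N r_f dK dstar κ c_T cχ P C X τ ϱ r₁ r₂ c₀ f ρ x with hmk
  set hc : (Fin 3 → ℤ) → ℝ := fun w' => holeCost τ (siteW ϱχ D σ X ϱ C) P r₁ c₀ f ρ w' with hhc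
  obtain ⟨hmw, hmax⟩ := hdom
  set a := hAxis ρ d w with ha
  -- common tools for a marked hole
  have hoct := fun {w' : Fin 3 → ℤ} (hw' : mk w') => marked_octahedron hϱ hϱχ hr₁ hsmall hlo hFr hf hρ hCF hw'
  have hcost := fun {w' : Fin 3 → ℤ} (hw' : mk w') =>
    holeCost_le_feetHoleCost (R_N := R_N) (x := x) hϱ hϱχ hr₁ hsmall hlo hFr hf hρ hCF hw'
  have hadm := fun {w' : Fin 3 → ℤ} (hw' : mk w') =>
    isFeetHole_of_marked (R_N := R_N) (x := x) hϱ hϱχ hr₁ hsmall hlo hFr hf hρ hCF hw'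
  have hne : C.Nonempty := (hoct hmw).1
  -- the marked holes of the domino of `w` as a finite set
  set M := (dl_marked_finite (ϱχ := ϱχ) (D := D) (σ := σ) (R_N := R_N) (r_f := r_f) (dK := dK) (dstar := dstar) (κ := κ) (c_T := c_T)
    (cχ := cχ) (τ := τ) (ϱ := ϱ) (r₁ := r₁) (r₂ := r₂) (C := C) (X := X) (c₀ := c₀) h1 hs hf hρ x).toFinset.filter
    (fun w' => SameDomino ρ d w w') with hM
  have hM_mem : ∀ w', w' ∈ M ↔ mk w' ∧ SameDomino ρ d w w' := fun w' => by
    rw [hM, Finset.mem_filter, Set.Finite.mem_toFinset, Set.mem_setOf_eq]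
  have hwM : w ∈ M := (hM_mem w).2 ⟨hmw, sameDomino_refl ρ d w⟩
  have hsum : domSum ϱχ D σ R_N r_f dK dstar κ c_T cχ P C X τ ϱ r₁ r₂ c₀ f ρ x w = ∑ w' ∈ M, hc w' := by
    unfold domSum
    rw [finsum_eq_sum_of_support_subset _ (show (Function.support fun w' => if mk w' ∧ SameDomino ρ d w w' then hc w' else 0) ⊆ ↑M
        from ?_)]
    · exact Finset.sum_congr rfl fun w' hw' => if_pos ((hM_mem w').1 hw')
    · intro w' hw'
      rw [Function.mem_support] at hw'
      rw [Finset.mem_coe, hM_mem]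
      by_contra hc'
      exact hw' (if_neg hc')
  have hc0 : ∀ w', 0 ≤ hc w' := fun w' => holeCost_nonneg τ _ P r₁ c₀ f ρ w'
  -- two holes of `M` with the same `(a+1)`-coordinate coincide (single crossing)
  have hline : ∀ w₁ w₂, w₁ ∈ M → w₂ ∈ M → w₁ (a + 1) = w₂ (a + 1) → w₁ = w₂ := fun w₁ w₂ hw₁ hw₂ h =>
    marked_domino_line hSC hx hxy ((hM_mem w₁).1 hw₁).1 ((hM_mem w₂).1 hw₂).1 ((hM_mem w₁).1 hw₁).2 ((hM_mem w₂).1 hw₂).2 h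
  -- the `(a+1)`-coordinates of `M` take at most two values
  have hkey : ∀ w₁ w₂, w₁ ∈ M → w₂ ∈ M → w₁ (a + 1) ≠ w (a + 1) → (w₂ (a + 1) = w (a + 1) ∨ w₂ (a + 1) = w₁ (a + 1)) := by
    intro w₁ w₂ hw₁ hw₂ hne₁
    have h₁ : w₁ (a + 1) - w₁ (a + 1) % 2 = w (a + 1) - w (a + 1) % 2 := (domKey_coords ((hM_mem w₁).1 hw₁).2.2).1
    have h₂ : w₂ (a + 1) - w₂ (a + 1) % 2 = w (a + 1) - w (a + 1) % 2 := (domKey_coords ((hM_mem w₂).1 hw₂).2.2).1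
    omega
  rw [hsum]
  by_cases hex : ∃ w₁ ∈ M, w₁ ≠ w
  · -- TWO marked holes on the domino: `w` and the partner `w₁`
    obtain ⟨w₁, hw₁, hne₁⟩ := hex
    have hmw₁ : mk w₁ := ((hM_mem w₁).1 hw₁).1
    have hsd₁ : SameDomino ρ d w w₁ := ((hM_mem w₁).1 hw₁).2
    have hca : w₁ (a + 1) ≠ w (a + 1) := fun h => hne₁ (hline w₁ w hw₁ hwM h)
    have hsub : M ⊆ {w, w₁} := by
      intro w₂ hw₂
      rw [Finset.mem_insert, Finset.mem_singleton]
      rcases hkey w₁ w₂ hw₁ hw₂ hca with h | h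
      · exact Or.inl (hline w₂ w hw₂ hwM h)
      · exact Or.inr (hline w₂ w₁ hw₂ hw₁ h)
    have hle : ∑ w' ∈ M, hc w' ≤ hc w + hc w₁ := by
      calc ∑ w' ∈ M, hc w' ≤ ∑ w' ∈ ({w, w₁} : Finset (Fin 3 → ℤ)), hc w' :=
            Finset.sum_le_sum_of_subset_of_nonneg hsub fun w' _ _ => hc0 w'
        _ = hc w + hc w₁ := Finset.sum_pair (Ne.symm hne₁)
    -- the fourteen-point obstacle
    set T := stencil w ∪ stencil w₁ with hT
    obtain ⟨S, hSne, hScard, hSd⟩ := feetSet_exists hne c₀ f ρ T ⟨w, Finset.mem_union_left _ (mem_stencil_self w)⟩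
    have hS14 : S.card ≤ 14 := hScard.trans ((Finset.card_union_le _ _).trans (add_le_add (card_stencil_le w) (card_stencil_le w₁)))
    have h0 : latDepth (↑S) c₀ f ρ w = d w := hSd w (Finset.mem_union_left _ (mem_stencil_self w))
    have hv : ∀ u, latDepth (↑S) c₀ f ρ (holeVertex w u) = d (holeVertex w u) := fun u =>
      hSd _ (Finset.mem_union_left _ (mem_stencil_vertex w u))
    have h0' : latDepth (↑S) c₀ f ρ w₁ = d w₁ := hSd w₁ (Finset.mem_union_right _ (mem_stencil_self w₁))
    have hv' : ∀ u, latDepth (↑S) c₀ f ρ (holeVertex w₁ u) = d (holeVertex w₁ u) := fun u =>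
      hSd _ (Finset.mem_union_right _ (mem_stencil_vertex w₁ u))
    -- the cap order from dominance
    have hcap : domCapK unit ϱ τ ρ (chargeDepth ρ d w₁) ≤ domCapK unit ϱ τ ρ (chargeDepth ρ d w) := by
      have hr := hmax w₁ hmw₁ hsd₁
      unfold domRankK at hr
      rcases Prod.Lex.toLex_le_toLex.1 hr with hlt | ⟨heq, -⟩
      · exact hlt.le
      · exact heq.le
    have hnl : ¬SameLine (hAxis ρ (latDepth (↑S) c₀ f ρ) w) w w₁ := by
      rw [hAxis_congr h0 hv]
      exact fun hl => hca (hl (a + 1) (fin3_succ_ne a)).symm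
    have hlaw := hD2 ρ hρ1 hρ2 c₀ f hf S hSne hS14 w w₁ ((isFeetHole_congr dK h0 hv).2 (hadm hmw))
      ((isFeetHole_congr dK h0' hv').2 (hadm hmw₁)) ((sameDomino_congr h0 hv h0' hv').2 hsd₁) hnl
      (by rw [chargeDepth_congr h0 hv, chargeDepth_congr h0' hv']; exact hcap)
    rw [feetHoleCost_congr ϱ τ hv, feetHoleCost_congr ϱ τ hv', chargeDepth_congr h0 hv] at hlaw
    exact hle.trans (((add_le_add (hcost hmw) (hcost hmw₁))).trans hlaw)
  · -- ONE marked hole on the domino: `w` alone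
    push Not at hex
    have hsub : M ⊆ {w} := fun w₂ hw₂ => Finset.mem_singleton.2 (hex w₂ hw₂)
    have hle : ∑ w' ∈ M, hc w' ≤ hc w := by
      calc ∑ w' ∈ M, hc w' ≤ ∑ w' ∈ ({w} : Finset (Fin 3 → ℤ)), hc w' :=
            Finset.sum_le_sum_of_subset_of_nonneg hsub fun w' _ _ => hc0 w'
        _ = hc w := Finset.sum_singleton _ _
    -- the seven-point obstacle
    obtain ⟨S, hSne, hScard, hSd⟩ := feetSet_exists hne c₀ f ρ (stencil w) ⟨w, mem_stencil_self w⟩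
    have hS7 : S.card ≤ 7 := hScard.trans (card_stencil_le w)
    have h0 : latDepth (↑S) c₀ f ρ w = d w := hSd w (mem_stencil_self w)
    have hv : ∀ u, latDepth (↑S) c₀ f ρ (holeVertex w u) = d (holeVertex w u) := fun u => hSd _ (mem_stencil_vertex w u)
    have hlaw := hD1 ρ hρ1 hρ2 c₀ f hf S hSne hS7 w ((isFeetHole_congr dK h0 hv).2 (hadm hmw))
    rw [feetHoleCost_congr ϱ τ hv, chargeDepth_congr h0 hv] at hlaw
    exact hle.trans ((hcost hmw).trans hlaw)

end Glue90

/-! ## §90.5 At the designate; the cone after NODE 90 -/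
section Designate90

/-- ★★★ **NODE 90 AT THE DESIGNATE (PROVED)**: (D¹) ∧ (D²) ⟹ (DL) `DominoLawQ' cls₀ 80 20 130 106 … (691/1000)` (`dK = 130`, `unit = c_T = 1/60000000`,
`ϱ = 160`, `τ = 3/100`, `ρ ∈ [0.679, 0.691]`). -/
theorem dominoLawQ'_designate_of_feetLaws
    (hD1 : SoloFeetLawQ 130 (1 / 60000000) 160 (3 / 100) (679 / 1000) (691 / 1000))
    (hD2 : PairFeetLawQ 130 (1 / 60000000) 160 (3 / 100) (679 / 1000) (691 / 1000)) :
    DominoLawQ'K cls₀ 80 20 130 106 (1 / 3600000000) (1 / 60000000) (1 / 2000000) (1 / 60000000) (3 / 5) (1 / 3) 3 (3 / 100) 160 80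
      (6 / 5) (3 / 2) (679 / 1000) (691 / 1000) :=
  dominoLawQ'_of_feetLaws (by norm_num) (by norm_num) (by norm_num) (by norm_num) (by norm_num) (by norm_num) hD1 hD2

/-- ★★ **NODE 90's LEAVES GIVE NODE 89's (PROVED, by name)**: `hD1`, `hD2` give NODE 89's local leaf `hDL`; `hDT` is kept. -/
theorem dominoLedger_leaves_of_feetLaw_leaves
    (hD1 : SoloFeetLawQ 130 (1 / 60000000) 160 (3 / 100) (679 / 1000) (691 / 1000))
    (hD2 : PairFeetLawQ 130 (1 / 60000000) 160 (3 / 100) (679 / 1000) (691 / 1000))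
    (hDT : DominoMatchingQ'K cls₀ 80 20 130 106 (1 / 3600000000) (1 / 60000000) (1 / 2000000) (1 / 60000000) (3 / 5) (1 / 3) 3 (3 / 100) 160
      80 (6 / 5) (3 / 2) (679 / 1000) (691 / 1000)) :
    DominoLawQ'K cls₀ 80 20 130 106 (1 / 3600000000) (1 / 60000000) (1 / 2000000) (1 / 60000000) (3 / 5) (1 / 3) 3 (3 / 100) 160 80
        (6 / 5) (3 / 2) (679 / 1000) (691 / 1000) ∧
      DominoMatchingQ'K cls₀ 80 20 130 106 (1 / 3600000000) (1 / 60000000) (1 / 2000000) (1 / 60000000) (3 / 5) (1 / 3) 3 (3 / 100) 160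
        80 (6 / 5) (3 / 2) (679 / 1000) (691 / 1000) :=
  ⟨dominoLawQ'_designate_of_feetLaws hD1 hD2, hDT⟩

/-- ★★★ **THE CONE AFTER NODE 90**: `ChargedEnergyGap` from NODE 89's cone `chargedEnergyGap_of_dominoLedger_numerics` with
`hDL ↦ dominoLawQ'_designate_of_feetLaws hD1 hD2` — 34 hypotheses: NODE 89's 33 binders VERBATIM with `hDL` replaced by
`hD1 : SoloFeetLawQ 130 (1/60000000) 160 (3/100) (679/1000) (691/1000)` (D¹) and `hD2 : PairFeetLawQ …` (D²); the residual-deciding binder of the lane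
stays `hDT` (DT), the local law is now the two FINITE-DIMENSIONAL feet laws. -/
theorem chargedEnergyGap_of_feetLaw_numerics {b₁ : ℝ} (hb : 1 / 8 ≤ b₁) (hU : Fcc.FccScaleNumerics) (hF : ChargeRecount)
    (hIP : ImprovablePricingG (3 / 20) (1 / 10) (6 / 5) 10 (1 / 100) (3 / 5))
    (hFCP : FrustratedCorePricingG (3 / 20) (1 / 10) (6 / 5) 10 (1 / 100) 40 (3 / 5))
    (hCCP : CoherentCorePricingG (3 / 20) (1 / 10) (6 / 5) 10 (1 / 100) 40 (1 / 10) 40 (3 / 5))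
    (hB : CoreBallRegularPricingW (maxCoverWeights (3 / 20) (1 / 10) (6 / 5) 10 (1 / 100) 40 (1 / 10) 40 160) (1 / 20) (3 / 5) 10
      fun _ _ => True)
    (hLab : CleanLabellingW (maxCoverWeights (3 / 20) (1 / 10) (6 / 5) 10 (1 / 100) 40 (1 / 10) 40 160) (3 / 5) 10 (1 / 3) 3)
    (hSB : ShellBudgetW (maxCoverWeights (3 / 20) (1 / 10) (6 / 5) 10 (1 / 100) 40 (1 / 10) 40 160) (3 / 5) 100000)
    (hLf : LoadBoundQ IsFccImage (3 / 5) (1 / 3) 3 (1 / 100) (3 / 100) 160 (2 / 5) 3 b₁ 80 (6 / 5) (3 / 4) (3 / 10000000) (9 / 1000000))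
    (hNf : NnStiffCls IsFccImage (27 / 10) (6 / 5))
    (hOL : OctLedgerQ (IsCubicFccImage (1921 / 2000) (977 / 1000)) (3 / 5) (1 / 3) 3 (1 / 100) (3 / 100) 160 (2 / 5) 3 b₁ 80 (6 / 5) (3 / 2)
      (1 / 2) (679 / 1000) (691 / 1000))
    (hA : A0Plus)
    (hT : RoofTableQ (471 / 1000) T75)
    (hZ : SixFeetZeroConeQ (679 / 1000) (691 / 1000) 20 106 160)
    (hCap : SixFeetShallowCapQ (679 / 1000) (691 / 1000) 20 106 160 (3 / 100) (1 / 3600000000))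
    (hI : SVertexIncidenceQ cls₀ 20 106 36 (3 / 5) (1 / 3) 3 160 80 (6 / 5) (3 / 2))
    (hZK : SixFeetZeroConeQ (679 / 1000) (691 / 1000) 330 130 160)
    (hSF : BallSupportQ 80 20 130 106 (1 / 3600000000) (1 / 60000000) (1 / 2000000) (3 / 5) (3 / 100) 160 80 (6 / 5) (3 / 2))
    (hD1 : SoloFeetLawQ 130 (1 / 60000000) 160 (3 / 100) (679 / 1000) (691 / 1000))
    (hD2 : PairFeetLawQ 130 (1 / 60000000) 160 (3 / 100) (679 / 1000) (691 / 1000))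
    (hDT : DominoMatchingQ'K cls₀ 80 20 130 106 (1 / 3600000000) (1 / 60000000) (1 / 2000000) (1 / 60000000) (3 / 5) (1 / 3) 3 (3 / 100) 160
      80 (6 / 5) (3 / 2) (679 / 1000) (691 / 1000))
    (hB2 : BallMatchingMultiQ' cls₀ 80 20 130 106 (1 / 3600000000) (1 / 60000000) (1 / 2000000) (3 / 5) (1 / 3) 3 (3 / 100) 160 80 (6 / 5)
      (3 / 2) (679 / 1000) (691 / 1000))
    (hPD : BandBallQ' cls₀ 80 20 130 106 (1 / 3600000000) (1 / 60000000) (1 / 2000000) (3 / 5) (1 / 3) 3 (3 / 100) 160 80 (6 / 5)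
      (3 / 2) (679 / 1000) (691 / 1000))
    (hNP : BallIncidenceQ' cls₀ 80 20 130 106 (1 / 3600000000) (1 / 60000000) (1 / 2000000) (3 / 5) (1 / 3) 3 (3 / 100) 160 80 (6 / 5)
      (3 / 2) (679 / 1000) (691 / 1000))
    (hFf : FarTrussQ IsFccImage (3 / 5) (1 / 3) 3 (1 / 100) (3 / 100) 160 (2 / 5) 3 b₁ 80 (6 / 5) (3 / 2) (11 / 20) (1 / 25) (1 / 60000000)
      (1 / 2000000))
    (hGf : GeoExchQ IsFccImage (3 / 5) (1 / 3) 3 (1 / 100) (3 / 100) 160 (2 / 5) 3 b₁ 80 (6 / 5) (3 / 20) (1 / 25) (1 / 30000000) (1 / 1000000))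
    (hLh : LoadBoundQ IsHcpImage (3 / 5) (1 / 3) 3 (1 / 100) (3 / 100) 160 (2 / 5) 3 b₁ 80 (6 / 5) (3 / 4) (3 / 10000000) (9 / 1000000))
    (hNh : NnStiffCls IsHcpImage (27 / 10) (6 / 5))
    (hMh : MidTrussQ IsHcpImage (3 / 5) (1 / 3) 3 (1 / 100) (3 / 100) 160 (2 / 5) 3 b₁ 80 (6 / 5) (3 / 2) (1 / 2) 0 (1 / 60000000) (1 / 2000000))
    (hFh : FarTrussQ IsHcpImage (3 / 5) (1 / 3) 3 (1 / 100) (3 / 100) 160 (2 / 5) 3 b₁ 80 (6 / 5) (3 / 2) (1 / 2) (1 / 40) (1 / 60000000)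
      (1 / 2000000))
    (hGh : GeoExchQ IsHcpImage (3 / 5) (1 / 3) 3 (1 / 100) (3 / 100) 160 (2 / 5) 3 b₁ 80 (6 / 5) (1 / 5) (1 / 40) (1 / 30000000) (1 / 1000000))
    (hN : LocalSeamReductionQ' (3 / 5) (1 / 3) 3 (1 / 100) (3 / 100) (1 / 2) 160 (2 / 5) 3 b₁ 80 (1 / 3000000) (1 / 100000)
      (maxCoverWeights (3 / 20) (1 / 10) (6 / 5) 10 (1 / 100) 40 (1 / 10) 40 160) (1 / 20) 10 100000)
    (hP : ChartedChargePricingG (3 / 20) (1 / 10) (3 / 5))  : ChargedEnergyGap :=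
  chargedEnergyGap_of_dominoLedger_numericsK hb hU hF hIP hFCP hCCP hB hLab hSB hLf hNf hOL hA hT hZ hCap hI hZK hSF
    (dominoLawQ'_designate_of_feetLaws hD1 hD2) hDT hB2 hPD hNP hFf hGf hLh hNh hMh hFh hGh hN hP

end Designate90

end Summit.AtomisticToContinuum.Crystallization.Theorems.ChargedEnergyGapChartDial

end
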